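import Mathlib
import Literature.NumberTheory.LFunctions.Zhang2022.TypedAppendixB
import HarnessLib

/-!
# Zhang (2022) Appendix B, proof of Lemma 15.1: the Perron identity for the `ϰ_μ`-weighted sums,
# generic in the parameters `(P_μ, β)` — `Σ_l ϰ_μ(l₁l)ϱ_j(l)/l = (1/2πi)∫_{(1)} ζ(1+s)/ζ(1+s−β_j)·(P_μ/l₁)ˢ/((log P_μ)(s−β)²) ds`

Topic `Literature/NumberTheory/LFunctions/Zhang2022` (Landau–Siegel audit tree; verdict-neutral).
Y. Zhang, *Discrete mean estimates and the Landau–Siegel zero*, arXiv:2211.02515v1 (2022)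
[Zhang2022LandauSiegel] — **an unrefereed manuscript under adjudication; nothing in this file asserts
any claim of the manuscript beyond the displayed identities it PROVES.** ZHANG-L discharge lane (WP15,
App. B blocks B3/B4 under leaf `Typed.Section15C.Eq15_22` / Lemma 15.1 χR), DAG nodes `Z22:§B.u008`,
`Z22:§B.u009` [Z22 p.107, tex L5292–L5296] and their `μ = 3`, `μ = 1` twins ("In case `μ = 3` the proof
can be obtained with `β₆` and `P₃` in place of `β₇` and `P₂`", "The same argument also gives …",
tex L5310–L5311).

The three weights of (8.6), `ϰ₁, ϰ₂, ϰ₃` (`Skeleton.vk1/vk2/vk3`), have ONE shape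
`ϰ(n) = (1 − log n/log P_μ)(P_μ/n)^β` (`n < P_μ`, else `0`) at `(P_μ, β) = (P₁, β₆), (P₂, β₇), (P₃, β₆)`.
The tree's `Typed.AppendixB.stepB_u008_holds` / `kerB_line` / `stepB_u009_holds` prove Perron's formula and
the term-by-term identity `Σ_l ϰ₂(l₁l)ϱ_j(l)/l = (1/2πi)∫_{(1)} intB2` at `(P₂, β₇)` only; this file is
their PARAMETER LIFT (same proofs, `(P_μ, β)` abstract with `1 < P_μ ≤ P`, `Re β = 0`):

* `vk_eq_vline_kerB` — Perron's formula `ϰ(m) = (1/2πi)∫_{(1)} (P_μ/m)ˢ/((log P_μ)(s − β)²) ds`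
  (GPY (6.6) with `m = 1`, the tree's `Literature.Analysis.Complex.integral_perronPow_vertical`, after the
  substitution `s = β + w`);
* `kerB_line_gen` — integrability of the kernel on `Re s = 1`, `∫|kerB| = π(P_μ/m)/log P_μ`,
  `∫ kerB = 2π·ϰ(m)`;
* `vkSum_eq_vline_kerB` — **the generic Perron identity**
  `Σ_l ϰ(l₁l)ϱ_j(l)/l = (1/2πi)∫_{(1)} ζ(1+s)/ζ(1+s−β_j)·(P_μ/l₁)ˢ/((log P_μ)(s−β)²) ds`
  (`StepB_u007` at `1+s`, Perron termwise, `Σ_l`/`∫` interchanged by absolute convergence);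
* the instances `vkSum_vk3_eq_vline` (`μ = 3`: hypothesis `h9` of `Skeleton.stepB_mu3R_of`,
  `AppendixBLemma151Mu3Circles`, VERBATIM) and `vkSum_vk1_eq_vline` (`μ = 1`, for the `StepB_u012R` chain),
  for `D ≥ 2` (`P₃, P₁ > 1`); `stepB_u009_of_generic` re-derives the tree's `StepB_u009` as a check.

WHAT THIS IS NOT: the contour shift (line → circle), the residue values, Lemma 15.1, or any claim about
Theorems 1–2 / Landau–Siegel zeros.

## References

* Y. Zhang, arXiv:2211.02515v1 (2022), App. B p. 107 (proof of Lemma 15.1), §8 (8.6).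
  [cite: Zhang2022LandauSiegel, App. B p.107]
* D. A. Goldston, J. Pintz, C. Y. Yıldırım, *Primes in tuples. I*, Ann. of Math. 170 (2009), §6 (6.6)
  (the Perron kernel `(1/2πi)∫_{(c)} yˢ s^{−m−1} ds`). [cite: GoldstonPintzYildirim2009, Section 6 eq. 6.6]
-/

noncomputable section

open Complex Real MeasureTheory

namespace Literature.NumberTheory.LFunctions.Zhang2022.Skeleton

open Typed.AppendixB (zetaRatio kerB vline vkSum varrhoJ)

/-! ## Perron's formula for the generic weight -/

section Generic

variable (c' : ℝ)

/-- **Perron's formula for the (8.6)-weight at `(P_μ, β)`** (generic `Z22:§B.u008`):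
for `P_μ > 1`, `Re β = 0`, `m ≥ 1`,
`ϰ(m) = (1/2πi)∫_{(1)} (P_μ/m)ˢ/((log P_μ)(s − β)²) ds` where `ϰ(m) = (1 − log m/log P_μ)(P_μ/m)^β`
for `m < P_μ` and `0` otherwise: substituting `s = β + w` (`β` purely imaginary, so `Re s = 1` is
`Re w = 1`), `(P_μ/m)^β(log P_μ)⁻¹·(1/2πi)∫_{(1)} yʷw⁻² dw` with `y = P_μ/m`, and
`(1/2πi)∫_{(1)} yʷw⁻² dw = log y` for `y ≥ 1`, `0` for `y ≤ 1`.
[cite: Zhang2022LandauSiegel, App. B p.107] [cite: GoldstonPintzYildirim2009, Section 6 eq. 6.6] -/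
theorem vk_eq_vline_kerB {Pμ : ℝ} (hPμ : 1 < Pμ) {β : ℂ} (hβ : β.re = 0) {vk : ℕ → ℂ}
    (hvk : ∀ n : ℕ, vk n =
      if (n : ℝ) < Pμ then (1 - Real.log n / Real.log Pμ : ℝ) * ((Pμ / n : ℝ) : ℂ) ^ β else 0)
    {m : ℕ} (hm : 1 ≤ m) :
    vk m = vline 1 (kerB Pμ β m) := by
  have hPμpos : 0 < Pμ := by linarith
  have hlogPμ : 0 < Real.log Pμ := Real.log_pos hPμ
  have hm0 : (0 : ℝ) < m := by exact_mod_cast hm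
  set y : ℝ := Pμ / m with hy
  have hy0 : 0 < y := div_pos hPμpos hm0
  have hy' : (y : ℂ) ≠ 0 := by exact_mod_cast hy0.ne'
  set b : ℝ := β.im with hb
  have hβb : β = (b : ℂ) * I := by
    apply Complex.ext <;> simp [hb, hβ]
  -- the integrand on the line `Re s = 1`, recentred at `β`
  set g : ℝ → ℂ := fun u => Literature.Analysis.Complex.perronPow y 1 (((1 : ℝ) : ℂ) + (u : ℂ) * I)
    with hg
  have hF : ∀ t : ℝ, kerB Pμ β m (((1 : ℝ) : ℂ) + (t : ℂ) * I) =
      ((y : ℂ) ^ β / (Real.log Pμ : ℂ)) * g (t - b) := by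
    intro t
    simp only [hg, kerB, Literature.Analysis.Complex.perronPow]
    have hsplit : ((1 : ℝ) : ℂ) + (t : ℂ) * I = β + (((1 : ℝ) : ℂ) + ((t - b : ℝ) : ℂ) * I) := by
      rw [hβb]; push_cast; ring
    rw [hsplit, Complex.cpow_add _ _ hy', add_sub_cancel_left]
    generalize (((1 : ℝ) : ℂ) + ((t - b : ℝ) : ℂ) * I) = w
    ring
  have hvline : vline 1 (kerB Pμ β m) =
      (1 / (2 * Real.pi) : ℂ) * (((y : ℂ) ^ β / (Real.log Pμ : ℂ)) * ∫ t : ℝ, g t) := by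
    rw [vline]
    congr 1
    simp_rw [hF]
    rw [MeasureTheory.integral_const_mul, MeasureTheory.integral_sub_right_eq_self g b]
  have hperron : ∫ t : ℝ, g t =
      if 1 ≤ y then 2 * Real.pi * (((Real.log y : ℝ) : ℂ) ^ 1 / ((1 : ℕ).factorial : ℂ)) else 0 :=
    Literature.Analysis.Complex.integral_perronPow_vertical hy0 one_pos le_rfl
  rw [hvline, hperron, hvk m, ← hy]
  have hπ : (Real.pi : ℂ) ≠ 0 := by exact_mod_cast Real.pi_ne_zero
  have hlog' : (Real.log Pμ : ℂ) ≠ 0 := by exact_mod_cast hlogPμ.ne'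
  by_cases hlt : (m : ℝ) < Pμ
  · -- `y > 1`
    have hy1 : 1 < y := by rw [hy, lt_div_iff₀ hm0]; linarith
    rw [if_pos hlt, if_pos hy1.le]
    have hlogy : Real.log y = Real.log Pμ - Real.log m := by
      rw [hy, Real.log_div hPμpos.ne' hm0.ne']
    rw [hlogy]
    push_cast
    field_simp
    ring
  · rw [if_neg hlt]
    push Not at hlt
    rcases hlt.eq_or_lt with heq | hgt
    · -- `y = 1`: `log y = 0`
      have hy1 : y = 1 := by rw [hy, ← heq, div_self hPμpos.ne']
      rw [if_pos hy1.ge, hy1, Real.log_one]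
      simp
    · -- `y < 1`
      have hy1 : ¬ 1 ≤ y := by
        rw [not_le, hy, div_lt_one hm0]; exact hgt
      rw [if_neg hy1]
      simp

/-- **The generic kernel on the line `Re s = 1`**: for `P_μ > 1`, `Re β = 0`, `m ≥ 1`, the function
`t ↦ (P_μ/m)^{1+it}/((log P_μ)(1+it−β)²)` is absolutely integrable with
`∫ |·| dt = π(P_μ/m)/log P_μ` and `∫ · dt = 2π·ϰ(m)` (`vk_eq_vline_kerB`).
[cite: Zhang2022LandauSiegel, App. B p.107] -/
theorem kerB_line_gen {Pμ : ℝ} (hPμ : 1 < Pμ) {β : ℂ} (hβ : β.re = 0) {vk : ℕ → ℂ}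
    (hvk : ∀ n : ℕ, vk n =
      if (n : ℝ) < Pμ then (1 - Real.log n / Real.log Pμ : ℝ) * ((Pμ / n : ℝ) : ℂ) ^ β else 0)
    {m : ℕ} (hm : 1 ≤ m) :
    Integrable (fun t : ℝ => kerB Pμ β m (((1 : ℝ) : ℂ) + (t : ℂ) * I)) ∧
    (∫ t : ℝ, ‖kerB Pμ β m (((1 : ℝ) : ℂ) + (t : ℂ) * I)‖) = Pμ / m / Real.log Pμ * π ∧
    (∫ t : ℝ, kerB Pμ β m (((1 : ℝ) : ℂ) + (t : ℂ) * I)) = 2 * π * vk m := by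
  have hPμpos : 0 < Pμ := by linarith
  have hlogPμ : 0 < Real.log Pμ := Real.log_pos hPμ
  have hm0 : (0 : ℝ) < m := by exact_mod_cast hm
  set y : ℝ := Pμ / m with hy
  have hy0 : 0 < y := div_pos hPμpos hm0
  have hy' : (y : ℂ) ≠ 0 := by exact_mod_cast hy0.ne'
  set b : ℝ := β.im with hb
  have hβb : β = (b : ℂ) * I := by
    apply Complex.ext <;> simp [hb, hβ]
  set g : ℝ → ℂ := fun u => Literature.Analysis.Complex.perronPow y 1 (((1 : ℝ) : ℂ) + (u : ℂ) * I)
    with hg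
  have hF : ∀ t : ℝ, kerB Pμ β m (((1 : ℝ) : ℂ) + (t : ℂ) * I) =
      ((y : ℂ) ^ β / (Real.log Pμ : ℂ)) * g (t - b) := by
    intro t
    simp only [hg, kerB, Literature.Analysis.Complex.perronPow]
    have hsplit : ((1 : ℝ) : ℂ) + (t : ℂ) * I = β + (((1 : ℝ) : ℂ) + ((t - b : ℝ) : ℂ) * I) := by
      rw [hβb]; push_cast; ring
    rw [hsplit, Complex.cpow_add _ _ hy', add_sub_cancel_left]
    generalize (((1 : ℝ) : ℂ) + ((t - b : ℝ) : ℂ) * I) = w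
    ring
  have hfun : (fun t : ℝ => kerB Pμ β m (((1 : ℝ) : ℂ) + (t : ℂ) * I)) =
      fun t => ((y : ℂ) ^ β / (Real.log Pμ : ℂ)) * g (t - b) :=
    funext hF
  have hgi : Integrable g :=
    Literature.Analysis.Complex.integrable_perronPow_vertical hy0 le_rfl one_ne_zero
  refine ⟨?_, ?_, ?_⟩
  · rw [hfun]; exact (hgi.comp_sub_right b).const_mul _
  · -- the norm: `‖kerB‖ = (y/log P_μ)(1 + (t−b)²)⁻¹`
    have hnorm : ∀ t : ℝ, ‖kerB Pμ β m (((1 : ℝ) : ℂ) + (t : ℂ) * I)‖ =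
        y / Real.log Pμ * (1 + (t - b) ^ 2)⁻¹ := by
      intro t
      simp only [kerB, ← hy]
      have hsub : ((1 : ℝ) : ℂ) + (t : ℂ) * I - β = ((1 : ℝ) : ℂ) + ((t - b : ℝ) : ℂ) * I := by
        rw [hβb]; push_cast; ring
      have hre : (((1 : ℝ) : ℂ) + (t : ℂ) * I).re = 1 := by simp
      rw [norm_div, norm_mul, norm_pow, hsub, Complex.norm_cpow_eq_rpow_re_of_pos hy0, hre,
        Real.rpow_one, Complex.norm_real, Real.norm_of_nonneg hlogPμ.le, Complex.sq_norm,
        Complex.normSq_add_mul_I, one_pow, div_mul_eq_div_div, div_eq_mul_inv]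
    simp_rw [hnorm]
    rw [MeasureTheory.integral_const_mul,
      MeasureTheory.integral_sub_right_eq_self (fun t : ℝ => (1 + t ^ 2)⁻¹) b,
      integral_univ_inv_one_add_sq, hy]
  · have h8 := vk_eq_vline_kerB hPμ hβ hvk hm
    rw [vline] at h8
    have hπ : (π : ℂ) ≠ 0 := by exact_mod_cast Real.pi_ne_zero
    rw [h8, ← mul_assoc, show (2 * (π : ℂ)) * (1 / (2 * π)) = 1 by field_simp, one_mul]

/-- **The generic Perron identity of Appendix B** (`Z22:§B.u009` and its `μ = 3`, `μ = 1` twins, for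
ANY `1 < P_μ ≤ P` and purely imaginary `β`): with `ϰ(n) = (1 − log n/log P_μ)(P_μ/n)^β` (`n < P_μ`, else
`0`), for every `j ∈ {1,2,3}` and `l₁ ≥ 1`,
`Σ_{1 ≤ l < P} ϰ(l₁l)ϱ_j(l)/l = (1/2πi)∫_{(1)} ζ(1+s)/ζ(1+s−β_j)·(P_μ/l₁)ˢ/((log P_μ)(s−β)²) ds`
— from `StepB_u007` at `1+s` (`Σ_l ϱ_j(l)l^{−1−s} = ζ(1+s)/ζ(1+s−β_j)`), Perron termwise
(`kerB_line_gen`) and the interchange of `Σ_l` and `∫` by absolute convergence (`Σ_l |ϱ_j(l)| l⁻² < ∞`,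
divisor bound); the terms with `l ≥ P ≥ P_μ` vanish. [cite: Zhang2022LandauSiegel, App. B p.107] -/
theorem vkSum_eq_vline_kerB {D : ℕ} {Pμ : ℝ} (hPμ : 1 < Pμ) (hPμP : Pμ ≤ bigP D) {β : ℂ}
    (hβ : β.re = 0) {vk : ℕ → ℂ}
    (hvk : ∀ n : ℕ, vk n =
      if (n : ℝ) < Pμ then (1 - Real.log n / Real.log Pμ : ℝ) * ((Pμ / n : ℝ) : ℂ) ^ β else 0)
    {j : ℕ} (hj : j ∈ ({1, 2, 3} : Finset ℕ)) {l₁ : ℕ} (hl₁ : 1 ≤ l₁) :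
    vkSum c' D vk j l₁ = vline 1 (fun s => zetaRatio c' D j s * kerB Pμ β l₁ s) := by
  have hPμpos : 0 < Pμ := by linarith
  have hlogPμ : 0 < Real.log Pμ := Real.log_pos hPμ
  have hl₁0 : (0 : ℝ) < l₁ := by exact_mod_cast hl₁
  -- the summands
  set G : ℕ → ℝ → ℂ := fun l t =>
    varrhoJ c' D j l / (l : ℂ) * kerB Pμ β (l₁ * l) (((1 : ℝ) : ℂ) + (t : ℂ) * I)
    with hGdef
  -- Step A: the integrand is `Σ' l, G l t`
  have hA : ∀ t : ℝ, zetaRatio c' D j (((1 : ℝ) : ℂ) + (t : ℂ) * I) *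
      kerB Pμ β l₁ (((1 : ℝ) : ℂ) + (t : ℂ) * I) = ∑' l : ℕ, G l t := by
    intro t
    simp only [zetaRatio, hGdef]
    set s : ℂ := ((1 : ℝ) : ℂ) + (t : ℂ) * I with hsdef
    have hs2 : 1 < (1 + s).re := by simp [hsdef]
    have h7 := Typed.AppendixB.stepB_u007_holds c' D j hj (1 + s) hs2
    rw [← h7, LSeries, ← tsum_mul_right]
    refine tsum_congr fun l => ?_
    rcases eq_or_ne l 0 with rfl | hl
    · simp
    have hl0 : (0 : ℝ) < l := by exact_mod_cast Nat.pos_of_ne_zero hl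
    have hlc : (l : ℂ) ≠ 0 := by exact_mod_cast hl
    rw [LSeries.term_of_ne_zero hl, kerB, kerB, Complex.cpow_add _ _ hlc, Complex.cpow_one,
      show (Pμ / (l₁ * l : ℕ) : ℝ) = Pμ / l₁ / l by push_cast; rw [div_div],
      GaussWeight.div_cpow_line (div_pos hPμpos hl₁0) hl0, Complex.ofReal_natCast]
    ring
  -- Step B/C: termwise integrability, norms and values
  have hker : ∀ l : ℕ, 1 ≤ l →
      Integrable (G l) ∧
      (∫ t : ℝ, ‖G l t‖) = ‖varrhoJ c' D j l‖ / l * (Pμ / (l₁ * l : ℕ) / Real.log Pμ * π) ∧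
      (∫ t : ℝ, G l t) = varrhoJ c' D j l / (l : ℂ) * (2 * π * vk (l₁ * l)) := by
    intro l hl
    obtain ⟨hi, hn, hv⟩ := kerB_line_gen hPμ hβ hvk (m := l₁ * l)
      (Nat.one_le_iff_ne_zero.mpr (mul_ne_zero (by omega) (by omega)))
    refine ⟨hi.const_mul _, ?_, ?_⟩
    · simp only [hGdef, norm_mul, MeasureTheory.integral_const_mul, hn, norm_div, Complex.norm_natCast]
    · simp only [hGdef, MeasureTheory.integral_const_mul, hv]
  have hG0 : G 0 = fun _ => 0 := by funext t; simp [hGdef]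
  have hint : ∀ l : ℕ, Integrable (G l) := by
    intro l
    rcases Nat.eq_zero_or_pos l with rfl | hl
    · rw [hG0]; exact integrable_zero _ _ _
    · exact (hker l hl).1
  have hsum : Summable fun l : ℕ => ∫ t : ℝ, ‖G l t‖ := by
    obtain ⟨C, hC1, hC⟩ :=
      Literature.NumberTheory.Sieve.exists_card_divisors_le_mul_rpow' (ε := (1 / 2 : ℝ)) (by norm_num)
    have hmaj : Summable (fun l : ℕ =>
        (C * (Pμ / l₁ / Real.log Pμ * π)) * (l : ℝ) ^ (-(3 / 2 : ℝ))) := by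
      refine (Real.summable_nat_rpow.mpr ?_).mul_left _
      norm_num
    refine hmaj.of_nonneg_of_le (fun l => integral_nonneg fun t => norm_nonneg _) fun l => ?_
    rcases Nat.eq_zero_or_pos l with rfl | hl
    · simp [hG0, Real.zero_rpow (by norm_num : -(3 / 2 : ℝ) ≠ 0)]
    rw [(hker l hl).2.1]
    have hl0 : (0 : ℝ) < l := by exact_mod_cast hl
    have hρ : ‖varrhoJ c' D j l‖ ≤ C * (l : ℝ) ^ (1 / 2 : ℝ) :=
      (Typed.AppendixB.norm_varrhoJ_le c' D j l).trans (hC l)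
    have hK : 0 ≤ Pμ / l₁ / Real.log Pμ * π := by positivity
    calc ‖varrhoJ c' D j l‖ / l * (Pμ / (l₁ * l : ℕ) / Real.log Pμ * π)
        = ‖varrhoJ c' D j l‖ * ((Pμ / l₁ / Real.log Pμ * π) * ((l : ℝ) * l)⁻¹) := by
          push_cast
          field_simp
      _ ≤ (C * (l : ℝ) ^ (1 / 2 : ℝ)) * ((Pμ / l₁ / Real.log Pμ * π) * ((l : ℝ) * l)⁻¹) := by
          gcongr
      _ = (C * (Pμ / l₁ / Real.log Pμ * π)) * ((l : ℝ) ^ (1 / 2 : ℝ) * ((l : ℝ) * l)⁻¹) := by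
          ring
      _ = (C * (Pμ / l₁ / Real.log Pμ * π)) * (l : ℝ) ^ (-(3 / 2 : ℝ)) := by
          congr 1
          rw [show ((l : ℝ) * l)⁻¹ = (l : ℝ) ^ (-(2 : ℝ)) by
            rw [Real.rpow_neg hl0.le, Real.rpow_two, pow_two], ← Real.rpow_add hl0]
          norm_num
  -- Step D: assemble
  rw [vline]
  simp_rw [hA]
  rw [← MeasureTheory.integral_tsum_of_summable_integral_norm hint hsum]
  have hval : ∀ l : ℕ, (∫ t : ℝ, G l t) = 2 * π * (vk (l₁ * l) * varrhoJ c' D j l / (l : ℂ)) := by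
    intro l
    rcases Nat.eq_zero_or_pos l with rfl | hl
    · simp [hG0]
    · rw [(hker l hl).2.2]; ring
  simp_rw [hval]
  rw [tsum_mul_left, ← mul_assoc]
  have hπ : (π : ℂ) ≠ 0 := by exact_mod_cast Real.pi_ne_zero
  have hone : (1 / (2 * (π : ℂ))) * (2 * π) = 1 := by field_simp
  rw [hone, one_mul, vkSum]
  symm
  refine tsum_eq_sum fun l hl => ?_
  -- terms outside `1 ≤ l < P` vanish
  rcases Nat.eq_zero_or_pos l with rfl | hlpos
  · simp
  · have hlP : ⌈bigP D⌉₊ ≤ l := by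
      by_contra h
      push Not at h
      exact hl (Finset.mem_Ico.mpr ⟨hlpos, h⟩)
    have hge : ¬ ((l₁ * l : ℕ) : ℝ) < Pμ := by
      push Not
      have hlreal : bigP D ≤ (l : ℝ) := le_trans (Nat.le_ceil _) (by exact_mod_cast hlP)
      calc Pμ ≤ bigP D := hPμP
        _ ≤ l := hlreal
        _ ≤ ((l₁ * l : ℕ) : ℝ) := by
            push_cast; exact le_mul_of_one_le_left (by positivity) (by exact_mod_cast hl₁)
    rw [hvk, if_neg hge, zero_mul, zero_div]

/-- The tree's `μ = 2` display `Typed.AppendixB.StepB_u009 c′` re-derived from the generic identity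
(a consistency check of the parameter lift; the tree's own proof is `stepB_u009_holds`).
[cite: Zhang2022LandauSiegel, App. B p.107] -/
theorem stepB_u009_of_generic : Typed.AppendixB.StepB_u009 c' := by
  refine ⟨8, fun D _ _ hD _ _ => ?_⟩
  intro j hj l₁ hl₁
  have hP2 : 1 < P2 D := Typed.AppendixB.one_lt_P2 hD
  have hP1 : 1 ≤ bigP D := by
    rw [bigP]; exact Real.one_le_exp (pow_nonneg (Real.log_natCast_nonneg D) 9)
  have hP2P : P2 D ≤ bigP D := by
    have hT : 1 ≤ bigT D := by
      rw [bigT]; exact Real.one_le_exp (Real.rpow_nonneg (Real.log_natCast_nonneg D) _)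
    have hT10 : 1 ≤ bigT D ^ 10 := one_le_pow₀ hT
    calc P2 D = bigP D ^ (0.5 : ℝ) / bigT D ^ 10 := rfl
      _ ≤ bigP D ^ (0.5 : ℝ) := div_le_self (by positivity) hT10
      _ ≤ bigP D ^ (1 : ℝ) := Real.rpow_le_rpow_of_exponent_le hP1 (by norm_num)
      _ = bigP D := Real.rpow_one _
  have hβ : (beta7 D).re = 0 := by simp [beta7]
  exact vkSum_eq_vline_kerB c' hP2 hP2P hβ (vk := vk2 D) (fun n => by rfl) hj hl₁

end Generic

/-! ## The instances `μ = 3` (`P₃, β₆`) and `μ = 1` (`P₁, β₆`) -/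

section Instances

variable (c' : ℝ)

/-- `P = exp(𝓛⁹) ≥ 1`. [cite: Zhang2022LandauSiegel, §2 (2.10)] -/
private theorem one_le_bigP (D : ℕ) : 1 ≤ bigP D := by
  rw [bigP]; exact Real.one_le_exp (pow_nonneg (Real.log_natCast_nonneg D) 9)

/-- `𝓛 = log D > 0` for `D ≥ 2`. [folklore] -/
private theorem ell_pos {D : ℕ} (hD : 2 ≤ D) : 0 < ell D := by
  rw [ell]; exact Real.log_pos (by exact_mod_cast hD)

/-- `P^θ > 1` for `D ≥ 2` and `θ > 0` (`P = exp(𝓛⁹)`, `𝓛 > 0`). [cite: Zhang2022LandauSiegel, §2 (2.10)] -/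
private theorem one_lt_bigP_rpow {D : ℕ} (hD : 2 ≤ D) {θ : ℝ} (hθ : 0 < θ) : 1 < bigP D ^ θ := by
  have hP : 1 < bigP D := by
    rw [bigP]; exact Real.one_lt_exp_iff.mpr (pow_pos (ell_pos hD) 9)
  exact Real.one_lt_rpow hP hθ

/-- `P^θ ≤ P` for `0 ≤ θ ≤ 1`. [cite: Zhang2022LandauSiegel, §2 (2.10)] -/
private theorem bigP_rpow_le (D : ℕ) {θ : ℝ} (hθ : θ ≤ 1) : bigP D ^ θ ≤ bigP D := by
  calc bigP D ^ θ ≤ bigP D ^ (1 : ℝ) := Real.rpow_le_rpow_of_exponent_le (one_le_bigP D) hθ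
    _ = bigP D := Real.rpow_one _

/-- `P₃ = P^{0.498} > 1` for `D ≥ 2`. [cite: Zhang2022LandauSiegel, §2 (2.21)] -/
theorem one_lt_P3 {D : ℕ} (hD : 2 ≤ D) : 1 < P3 D := one_lt_bigP_rpow hD (by norm_num)

/-- `P₁ = P^{0.504} > 1` for `D ≥ 2`. [cite: Zhang2022LandauSiegel, §2 (2.21)] -/
theorem one_lt_P1 {D : ℕ} (hD : 2 ≤ D) : 1 < P1 D := one_lt_bigP_rpow hD (by norm_num)

/-- `P₃ ≤ P`. [cite: Zhang2022LandauSiegel, §2 (2.21)] -/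
theorem P3_le_bigP (D : ℕ) : P3 D ≤ bigP D := bigP_rpow_le D (by norm_num)

/-- `P₁ ≤ P`. [cite: Zhang2022LandauSiegel, §2 (2.21)] -/
theorem P1_le_bigP (D : ℕ) : P1 D ≤ bigP D := bigP_rpow_le D (by norm_num)

/-- `Re β₆ = 0` (`β₆ = 3iα/2`; the tree's `Typed.Sec12A.beta6_re`, restated privately to keep this
file's imports to `TypedAppendixB`). [cite: Zhang2022LandauSiegel, §2 (2.22)] -/
private theorem beta6_re' (D : ℕ) : (beta6 D).re = 0 := by simp [beta6]

/-- **The `μ = 3` Perron identity** ("In case `μ = 3` the proof can be obtained with `β₆` and `P₃` in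
place of `β₇` and `P₂`", App. B p. 107): for `D ≥ 2`, every `j ∈ {1,2,3}` and `l₁ ≥ 1`,
`Σ_l ϰ₃(l₁l)ϱ_j(l)/l = (1/2πi)∫_{(1)} ζ(1+s)/ζ(1+s−β_j)·(P₃/l₁)ˢ/((log P₃)(s−β₆)²) ds` — the hypothesis
`h9` of `Skeleton.stepB_mu3R_of` (`AppendixBLemma151Mu3Circles`) VERBATIM, now a theorem.
[cite: Zhang2022LandauSiegel, App. B p.107] -/
theorem vkSum_vk3_eq_vline : ForAllLarge fun D _ _ => ∀ j ∈ ({1, 2, 3} : Finset ℕ), ∀ l₁ : ℕ,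
    1 ≤ l₁ → vkSum c' D (vk3 D) j l₁ =
      vline 1 (fun s => zetaRatio c' D j s * kerB (P3 D) (beta6 D) l₁ s) := by
  refine ⟨2, fun D _ _ hD _ _ j hj l₁ hl₁ => ?_⟩
  exact vkSum_eq_vline_kerB c' (one_lt_P3 hD) (P3_le_bigP D) (beta6_re' D) (vk := vk3 D)
    (fun n => by rfl) hj hl₁

/-- The `μ = 3` Perron identity at a given modulus `D ≥ 2` (pointwise form of `vkSum_vk3_eq_vline`).
[cite: Zhang2022LandauSiegel, App. B p.107] -/
theorem vkSum_vk3_eq_vline_of_le {D : ℕ} (hD : 2 ≤ D) {j : ℕ} (hj : j ∈ ({1, 2, 3} : Finset ℕ))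
    {l₁ : ℕ} (hl₁ : 1 ≤ l₁) :
    vkSum c' D (vk3 D) j l₁ = vline 1 (fun s => zetaRatio c' D j s * kerB (P3 D) (beta6 D) l₁ s) :=
  vkSum_eq_vline_kerB c' (one_lt_P3 hD) (P3_le_bigP D) (beta6_re' D) (vk := vk3 D)
    (fun n => by rfl) hj hl₁

/-- **The `μ = 1` Perron identity** (first step of "The same argument also gives
`Σ_l ϰ₁(l₁l)ϱ_j(l)/l = e′_{1j} + O(α₁)`", App. B p. 107, `Z22:§B.u012`): for `D ≥ 2`, every
`j ∈ {1,2,3}` and `l₁ ≥ 1`,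
`Σ_l ϰ₁(l₁l)ϱ_j(l)/l = (1/2πi)∫_{(1)} ζ(1+s)/ζ(1+s−β_j)·(P₁/l₁)ˢ/((log P₁)(s−β₆)²) ds`.
[cite: Zhang2022LandauSiegel, App. B p.107] -/
theorem vkSum_vk1_eq_vline : ForAllLarge fun D _ _ => ∀ j ∈ ({1, 2, 3} : Finset ℕ), ∀ l₁ : ℕ,
    1 ≤ l₁ → vkSum c' D (vk1 D) j l₁ =
      vline 1 (fun s => zetaRatio c' D j s * kerB (P1 D) (beta6 D) l₁ s) := by
  refine ⟨2, fun D _ _ hD _ _ j hj l₁ hl₁ => ?_⟩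
  exact vkSum_eq_vline_kerB c' (one_lt_P1 hD) (P1_le_bigP D) (beta6_re' D) (vk := vk1 D)
    (fun n => by rfl) hj hl₁

/-- The `μ = 1` Perron identity at a given modulus `D ≥ 2` (pointwise form of `vkSum_vk1_eq_vline`).
[cite: Zhang2022LandauSiegel, App. B p.107] -/
theorem vkSum_vk1_eq_vline_of_le {D : ℕ} (hD : 2 ≤ D) {j : ℕ} (hj : j ∈ ({1, 2, 3} : Finset ℕ))
    {l₁ : ℕ} (hl₁ : 1 ≤ l₁) :
    vkSum c' D (vk1 D) j l₁ = vline 1 (fun s => zetaRatio c' D j s * kerB (P1 D) (beta6 D) l₁ s) :=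
  vkSum_eq_vline_kerB c' (one_lt_P1 hD) (P1_le_bigP D) (beta6_re' D) (vk := vk1 D)
    (fun n => by rfl) hj hl₁

/-- The kernels of `ϰ₃` and `ϰ₁` on the line `Re s = 1` (for the contour bookkeeping of the `μ = 3, 1`
chains): integrable, with `∫ |kerB| = π(P_μ/m)/log P_μ` and `∫ kerB = 2π·ϰ_μ(m)`, `D ≥ 2`, `m ≥ 1`.
[cite: Zhang2022LandauSiegel, App. B p.107] -/
theorem kerB_line_vk3 {D : ℕ} (hD : 2 ≤ D) {m : ℕ} (hm : 1 ≤ m) :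
    Integrable (fun t : ℝ => kerB (P3 D) (beta6 D) m (((1 : ℝ) : ℂ) + (t : ℂ) * I)) ∧
    (∫ t : ℝ, ‖kerB (P3 D) (beta6 D) m (((1 : ℝ) : ℂ) + (t : ℂ) * I)‖) = P3 D / m / Real.log (P3 D) * π ∧
    (∫ t : ℝ, kerB (P3 D) (beta6 D) m (((1 : ℝ) : ℂ) + (t : ℂ) * I)) = 2 * π * vk3 D m :=
  kerB_line_gen (one_lt_P3 hD) (beta6_re' D) (vk := vk3 D) (fun n => by rfl) hm

/-- The kernel of `ϰ₁` on the line `Re s = 1`: integrable, `∫ |kerB| = π(P₁/m)/log P₁`,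
`∫ kerB = 2π·ϰ₁(m)` (`D ≥ 2`, `m ≥ 1`). [cite: Zhang2022LandauSiegel, App. B p.107] -/
theorem kerB_line_vk1 {D : ℕ} (hD : 2 ≤ D) {m : ℕ} (hm : 1 ≤ m) :
    Integrable (fun t : ℝ => kerB (P1 D) (beta6 D) m (((1 : ℝ) : ℂ) + (t : ℂ) * I)) ∧
    (∫ t : ℝ, ‖kerB (P1 D) (beta6 D) m (((1 : ℝ) : ℂ) + (t : ℂ) * I)‖) = P1 D / m / Real.log (P1 D) * π ∧
    (∫ t : ℝ, kerB (P1 D) (beta6 D) m (((1 : ℝ) : ℂ) + (t : ℂ) * I)) = 2 * π * vk1 D m :=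
  kerB_line_gen (one_lt_P1 hD) (beta6_re' D) (vk := vk1 D) (fun n => by rfl) hm

end Instances

end Literature.NumberTheory.LFunctions.Zhang2022.Skeleton
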